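import Summits.CriticalPhenomena.CardyFormulaZ2.Theses.CardyBoundaryCoulombGas
import Summits.CriticalPhenomena.CardyFormulaZ2.Theorems.CardyBoundaryCoulombGasPureProductIntegrates
import Literature.Probability.RandomPlanarGeometry.CardyFunctionIncBeta

/-!
# Stub `stub_betaRatioIdentity` of line `excursion-kernel-covariance`
# (crux `RectilinearCardy`, stmt-CriticalPhenomena-5660, route `CardyBoundaryCoulombGas`)

Pure calculus (the "beta ratio identity"): for a strictly monotone or strictly antitone
`x : Fin 4 → ℝ`,
`∫_{x₂}^{x₃} ω_x / ∫_{x₁}^{x₃} ω_x = F(η(x))`, where `ω_x(t) = |(t - x₀)(t - x₁)(t - x₃)|^{-2/3}`,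
`F` is Cardy's function and `η` is Cardy's cross-ratio.

Proof. For `x₀ < x₁ < x₃` put `G(t) := F(η(x₁, x₀, x₃, t))`; then
`η(x₁,x₀,x₃,t) = (x₁-x₀)(x₃-t)/((x₃-x₁)(t-x₀)) ∈ [0, 1]` on `[x₁, x₃]`, so `G` is continuous there
(`F` is continuous on `[0,1]`), `G(x₁) = F(1) = 1`, `G(x₃) = F(0) = 0`, and by Cardy's ODE
`F'(η) = (cardyConst/3)(η(1-η))^{-2/3}` (Cardy 1992, eq. (8)) and the chain rule
`G'(t) = -c·ω_x(t)` on `(x₁, x₃)` with the constant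
`c = (cardyConst/3)((x₁-x₀)(x₃-x₀)(x₃-x₁))^{1/3}`.
A continuous function with nonnegative derivative has integrable derivative
(`intervalIntegral.integrableOn_deriv_of_nonneg`), so the fundamental theorem of calculus gives
`c ∫_{s}^{x₃} ω_x = G(s)` for every `s ∈ [x₁, x₃]`; with `s = x₂` and `s = x₁` the ratio is
`G(x₂)/1 = F(η(x))` since `η(x₁,x₀,x₃,x₂) = η(x)`. Antitone data reduce to monotone ones by the
reflection `t ↦ -t` (`crossRatio_neg`), under which both integrals change sign.
-/

noncomputable section

open Set Filter Topology MeasureTheory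

namespace Summit.CriticalPhenomena.CardyFormulaZ2.Cruxes.RectilinearCardy.ExcursionKernelCovariance

open Literature.Probability.RandomPlanarGeometry
open Summit.CriticalPhenomena.CardyFormulaZ2.Theorems

/-- Swapping the first two and the last two points does not change Cardy's cross-ratio:
`η(b, a, d, t) = η(a, b, t, d)`. [folklore] -/
theorem crossRatio_swap_pairs (a b d t : ℝ) :
    crossRatio ![b, a, d, t] = crossRatio ![a, b, t, d] := by
  simp only [crossRatio, Matrix.cons_val_zero, Matrix.cons_val_one, Matrix.cons_val]
  ring

/-- For `a < b < t < d` the cross-ratio `η(b, a, d, t)` lies in `(0, 1)`. [folklore] -/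
theorem crossRatio_third_mem_Ioo {a b d t : ℝ} (hab : a < b) (hbt : b < t) (htd : t < d) :
    crossRatio ![b, a, d, t] ∈ Ioo (0 : ℝ) 1 := by
  rw [crossRatio_swap_pairs]
  refine crossRatio_mem_Ioo (Or.inl (Fin.strictMono_iff_lt_succ.2 fun i ↦ ?_))
  fin_cases i
  · simpa using hab
  · simpa using hbt
  · simpa using htd

/-- Chain rule with the third point moving: for `a < b < t < d`,
`d/dt F(η(b, a, d, t)) = -(cardyConst/3)·((b-a)(d-a)(d-b))^{1/3}·|(t-a)(t-b)(t-d)|^{-2/3}`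
(Cardy's ODE `F'(η) = (cardyConst/3)(η(1-η))^{-2/3}` composed with the cross-ratio).
[cite: CardyJPhysA1992, eq. (8)] -/
theorem hasDerivAt_cardyFunction_crossRatio_third {a b d t : ℝ} (hab : a < b) (hbt : b < t)
    (htd : t < d) :
    HasDerivAt (fun y : ℝ ↦ cardyFunction (crossRatio ![b, a, d, y]))
      (-(cardyConst / 3 * ((b - a) * (d - a) * (d - b)) ^ (1 / 3 : ℝ) *
        |(t - a) * (t - b) * (t - d)| ^ (-(2 / 3 : ℝ)))) t := by
  have hF := hasDerivAt_cardyFunction_holds (crossRatio_third_mem_Ioo hab hbt htd)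
  have hηd := hasDerivAt_crossRatio_fourth (a := b) (b := a) (c := d) (x := t)
    (hbt.trans htd).ne (hab.trans hbt).ne'
  refine (hF.comp t hηd).congr_deriv ?_
  have h1 : 0 < b - a := sub_pos.2 hab
  have h2 : 0 < d - a := sub_pos.2 ((hab.trans hbt).trans htd)
  have h3 : 0 < d - b := sub_pos.2 (hbt.trans htd)
  have h4 : 0 < t - a := sub_pos.2 (hab.trans hbt)
  have h5 : 0 < t - b := sub_pos.2 hbt
  have h6 : 0 < d - t := sub_pos.2 htd
  have hΔ : 0 < (b - a) * (d - a) * (d - b) := by positivity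
  have hQ : 0 < (t - a) * (t - b) * (d - t) := by positivity
  have hK : 0 < (d - b) * (t - a) := by positivity
  have h3' : d - b ≠ 0 := h3.ne'
  have h4' : t - a ≠ 0 := h4.ne'
  have habs : |(t - a) * (t - b) * (t - d)| = (t - a) * (t - b) * (d - t) := by
    rw [show (t - a) * (t - b) * (t - d) = -((t - a) * (t - b) * (d - t)) by ring, abs_neg]
    exact abs_of_pos hQ
  have hprod : crossRatio ![b, a, d, t] * (1 - crossRatio ![b, a, d, t]) =
      (b - a) * (d - a) * (d - b) * ((t - a) * (t - b) * (d - t)) / ((d - b) * (t - a)) ^ 3 := by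
    rw [crossRatio_abcx]
    field_simp
    ring
  have hder : (a - b) * (d - a) / ((d - b) * (t - a) ^ 2) =
      -((b - a) * (d - a) * (d - b) / ((d - b) * (t - a)) ^ 2) := by
    field_simp
    ring
  rw [hprod, hder, habs, mul_neg, mul_assoc, pureProduct_rpow_identity hΔ hQ hK, ← mul_assoc]

/-- For `a < b < d`, `t ↦ F(η(b, a, d, t))` is continuous on `[b, d]`
(`η(b,a,d,·)` is continuous there with values in `[0, 1]`, and `F` is continuous on `[0, 1]`).
[folklore] -/
theorem continuousOn_cardyFunction_crossRatio_third {a b d : ℝ} (hab : a < b) (hbd : b < d) :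
    ContinuousOn (fun y : ℝ ↦ cardyFunction (crossRatio ![b, a, d, y])) (Icc b d) := by
  have hη : ContinuousOn (fun y : ℝ ↦ (a - b) * (y - d) / ((d - b) * (y - a))) (Icc b d) := by
    refine ContinuousOn.div (by fun_prop) (by fun_prop) fun y hy ↦ ?_
    exact mul_ne_zero (sub_pos.2 hbd).ne' (sub_pos.2 (hab.trans_le hy.1)).ne'
  have hmaps : MapsTo (fun y : ℝ ↦ (a - b) * (y - d) / ((d - b) * (y - a))) (Icc b d)
      (Icc 0 1) := by
    intro y hy
    have hden : 0 < (d - b) * (y - a) := mul_pos (sub_pos.2 hbd) (sub_pos.2 (hab.trans_le hy.1))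
    refine ⟨div_nonneg ?_ hden.le, (div_le_one hden).2 ?_⟩
    · nlinarith [mul_nonneg (sub_nonneg.2 hab.le) (sub_nonneg.2 hy.2)]
    · nlinarith [mul_nonneg (sub_nonneg.2 hy.1) (sub_nonneg.2 (hab.trans hbd).le)]
  have hF : ContinuousOn cardyFunction (Icc 0 1) := continuousOn_cardyFunction_holds
  refine (hF.comp hη hmaps).congr fun y _ ↦ ?_
  simp only [Function.comp_apply, crossRatio_abcx]

/-- The integrated form of Cardy's ODE along the third point: for `a < b < d` and `s ∈ [b, d]`,
`(cardyConst/3)·((b-a)(d-a)(d-b))^{1/3} · ∫_s^d |(t-a)(t-b)(t-d)|^{-2/3} dt = F(η(b, a, d, s))`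
(fundamental theorem of calculus; the derivative is of constant sign, hence integrable, and
`F(η(b,a,d,d)) = F(0) = 0`). [cite: CardyJPhysA1992, eq. (8)] -/
theorem cardyConst_mul_integral_eq_cardyFunction {a b d s : ℝ} (hab : a < b) (hbd : b < d)
    (hs : s ∈ Icc b d) :
    cardyConst / 3 * ((b - a) * (d - a) * (d - b)) ^ (1 / 3 : ℝ) *
        ∫ t in s..d, |(t - a) * (t - b) * (t - d)| ^ (-(2 / 3 : ℝ)) =
      cardyFunction (crossRatio ![b, a, d, s]) := by
  have hc0 : 0 < cardyConst / 3 * ((b - a) * (d - a) * (d - b)) ^ (1 / 3 : ℝ) := by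
    have h1 : 0 < b - a := sub_pos.2 hab
    have h2 : 0 < d - a := sub_pos.2 (hab.trans hbd)
    have h3 : 0 < d - b := sub_pos.2 hbd
    have := cardyConst_pos
    positivity
  have hGc : ContinuousOn (fun y : ℝ ↦ -cardyFunction (crossRatio ![b, a, d, y])) (Icc s d) :=
    ((continuousOn_cardyFunction_crossRatio_third hab hbd).mono (Icc_subset_Icc_left hs.1)).neg
  have hGd : ∀ t ∈ Ioo s d, HasDerivAt (fun y : ℝ ↦ -cardyFunction (crossRatio ![b, a, d, y]))
      (cardyConst / 3 * ((b - a) * (d - a) * (d - b)) ^ (1 / 3 : ℝ) *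
        |(t - a) * (t - b) * (t - d)| ^ (-(2 / 3 : ℝ))) t := fun t ht ↦ by
    simpa only [neg_neg] using
      (hasDerivAt_cardyFunction_crossRatio_third hab (hs.1.trans_lt ht.1) ht.2).fun_neg
  have hint := intervalIntegral.integrableOn_deriv_of_nonneg hGc hGd fun t _ ↦
    mul_nonneg hc0.le (Real.rpow_nonneg (abs_nonneg _) _)
  have hftc := intervalIntegral.integral_eq_sub_of_hasDerivAt_of_le hs.2 hGc hGd
    ((intervalIntegrable_iff_integrableOn_Ioc_of_le hs.2).2 hint)
  rw [intervalIntegral.integral_const_mul] at hftc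
  have h0 : cardyFunction (crossRatio ![b, a, d, d]) = 0 := by
    rw [crossRatio_abcx]
    simp
  rw [hftc, h0]
  ring

/-- Elementary: if `c ≠ 0`, `c·p = F` and `c·q = 1` then `p/q = F`. [folklore] -/
theorem div_eq_of_const_mul_eq {c p q F : ℝ} (hc : c ≠ 0) (hp : c * p = F) (hq : c * q = 1) :
    p / q = F := by
  rw [← mul_div_mul_left p q hc, hp, hq, div_one]

/-- The beta ratio identity for strictly monotone data:
`∫_{x₂}^{x₃} ω_x / ∫_{x₁}^{x₃} ω_x = F(η(x))`, `ω_x(t) = |(t-x₀)(t-x₁)(t-x₃)|^{-2/3}`.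
[cite: CardyJPhysA1992, eq. (8)] -/
theorem betaRatioIdentity_of_strictMono {x : Fin 4 → ℝ} (hx : StrictMono x) :
    (∫ t in x 2..x 3, |(t - x 0) * (t - x 1) * (t - x 3)| ^ (-(2 / 3 : ℝ))) /
        (∫ t in x 1..x 3, |(t - x 0) * (t - x 1) * (t - x 3)| ^ (-(2 / 3 : ℝ))) =
      cardyFunction (crossRatio x) := by
  have h01 : x 0 < x 1 := hx (show (0 : Fin 4) < 1 by decide)
  have h12 : x 1 < x 2 := hx (show (1 : Fin 4) < 2 by decide)
  have h23 : x 2 < x 3 := hx (show (2 : Fin 4) < 3 by decide)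
  have h13 : x 1 < x 3 := h12.trans h23
  have hc0 : cardyConst / 3 * ((x 1 - x 0) * (x 3 - x 0) * (x 3 - x 1)) ^ (1 / 3 : ℝ) ≠ 0 := by
    have h1 : 0 < x 1 - x 0 := sub_pos.2 h01
    have h2 : 0 < x 3 - x 0 := sub_pos.2 (h01.trans h13)
    have h3 : 0 < x 3 - x 1 := sub_pos.2 h13
    have := cardyConst_pos
    positivity
  have h2 := cardyConst_mul_integral_eq_cardyFunction h01 h13 ⟨h12.le, h23.le⟩
  have h1 := cardyConst_mul_integral_eq_cardyFunction h01 h13 ⟨le_rfl, h13.le⟩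
  have e1 : crossRatio ![x 1, x 0, x 3, x 1] = 1 := by
    rw [crossRatio_abcx,
      div_eq_one_iff_eq (mul_ne_zero (sub_pos.2 h13).ne' (sub_pos.2 h01).ne')]
    ring
  have e2 : crossRatio ![x 1, x 0, x 3, x 2] = crossRatio x := by
    simp only [crossRatio, Matrix.cons_val_zero, Matrix.cons_val_one, Matrix.cons_val]
    ring
  rw [e1, show cardyFunction 1 = 1 from cardyFunction_one_holds] at h1
  rw [e2] at h2
  exact div_eq_of_const_mul_eq hc0 h2 h1

/-- Reflection `t ↦ -t`: the `ω`-integrals of the datum `-x` are minus those of `x`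
(`ω_{-x}(t) = ω_x(-t)`). [folklore] -/
theorem integral_betaWeight_neg (x : Fin 4 → ℝ) (p : ℝ) :
    ∫ t in -p..-x 3, |(t - -x 0) * (t - -x 1) * (t - -x 3)| ^ (-(2 / 3 : ℝ)) =
      -∫ t in p..x 3, |(t - x 0) * (t - x 1) * (t - x 3)| ^ (-(2 / 3 : ℝ)) := by
  have h := intervalIntegral.integral_comp_neg (a := -p) (b := -x 3)
    (f := fun s : ℝ ↦ |(s - x 0) * (s - x 1) * (s - x 3)| ^ (-(2 / 3 : ℝ)))
  simp only [neg_neg] at h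
  rw [← intervalIntegral.integral_symm, ← h]
  congr 1
  funext t
  rw [show (-t - x 0) * (-t - x 1) * (-t - x 3) = -((t - -x 0) * (t - -x 1) * (t - -x 3)) by ring,
    abs_neg]

/-- **Stub `stub_betaRatioIdentity`** (the line's `BetaRatioIdentity` with `betaRatio`/`betaWeight`
inlined): for a strictly monotone or strictly antitone `x : Fin 4 → ℝ`,
`∫_{x₂}^{x₃} |(t-x₀)(t-x₁)(t-x₃)|^{-2/3} dt / ∫_{x₁}^{x₃} |(t-x₀)(t-x₁)(t-x₃)|^{-2/3} dt = F(η(x))`,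
`F` Cardy's function, `η` Cardy's cross-ratio — the integrated form of Cardy's ODE
`F'(η) = (cardyConst/3)(η(1-η))^{-2/3}`. [cite: CardyJPhysA1992, eq. (8)] -/
theorem stub_betaRatioIdentity :
    ∀ x : Fin 4 → ℝ, (StrictMono x ∨ StrictAnti x) →
      (∫ t in x 2..x 3, |(t - x 0) * (t - x 1) * (t - x 3)| ^ (-(2 / 3 : ℝ))) /
          (∫ t in x 1..x 3, |(t - x 0) * (t - x 1) * (t - x 3)| ^ (-(2 / 3 : ℝ))) =
        cardyFunction (crossRatio x) := by
  intro x hx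
  rcases hx with hx | hx
  · exact betaRatioIdentity_of_strictMono hx
  · have hy : StrictMono (-x) := fun i j hij ↦ neg_lt_neg (hx hij)
    rw [← crossRatio_neg x, ← betaRatioIdentity_of_strictMono hy]
    simp only [Pi.neg_apply]
    rw [integral_betaWeight_neg x (x 2), integral_betaWeight_neg x (x 1), neg_div_neg_eq]

end Summit.CriticalPhenomena.CardyFormulaZ2.Cruxes.RectilinearCardy.ExcursionKernelCovariance

end
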